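import Literature.Barriers.BirchSwinnertonDyer.RankNotSumOfLocalInvariantsK1Digits
import HarnessLib

/-!
# `rk E(F₄)` for `E = 480a1` via `ℚ(√-1)`, IV: the local characters on the generators of `K1(S,2)`

The values of the seventeen local square-class characters of file III — the eight valuation
parities `ord_{gen k} (mod 2)`, the six quadratic-residue bits at the split primes
`2 ± i, 5 ± 4i, 8 ± 3i` and the three dyadic bits `re, nrm, t` at `1 + i` — on the nine
generators `i, gen 0 = 1+i, gen 1 = 3, gen 2 = 2+i, gen 3 = 2-i, gen 4 = 5+4i, gen 5 = 5-4i,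
gen 6 = 8+3i, gen 7 = 8-3i` of `K1(S,2)` (file II). This is the "localisation matrix" of the
complete `2`-descents over `K1 = ℚ(√-1)` (Silverman AEC X.1: the map
`K(S,2) → ∏_{v ∈ S} K_v^×/K_v^{×2}` in coordinates); it has full rank `9`, the columns
`ord_{gen k}` (`k = 0..7`) and `qr_{2+i}` already being invertible (`qr_{2+i}(i) = 1`). Every
entry is a finite computation (a residue in `𝔽₅, 𝔽₄₁, 𝔽₇₃` being a square or not, a residue in
`(ℤ/8)[i]`), checked by `decide`. Everything is proved.

## References

* J. H. Silverman, *The Arithmetic of Elliptic Curves*, 2nd ed., GTM 106 (2009), Ch. X §1,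
  Prop. X.1.4, Example X.1.5. [SilvermanAEC2009]
* T. Dokchitser, V. Dokchitser, *A note on the Mordell–Weil rank modulo `n`*, J. Number Theory
  131 (2011) 1833–1839, arXiv:0910.4588, proof of Thm. 2. [DokchitserDokchitser2011RankModN]
-/

namespace Literature.Barriers.BirchSwinnertonDyer.DokchitserDokchitser2011

open QuadraticAlgebra

/-- Mathlib's Gaussian integers `ℤ√-1` (the notation `ℤ[i]` is local to Mathlib's file). -/
local notation "ℤ[i]" => GaussianInt

/-! ### Non-divisibility among the generators -/

/-- No generator is a unit multiple of another (finite check on `±1, ±i`). [folklore] -/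
theorem gen_mul_unit_ne : ∀ k j : Fin 8, k ≠ j →
    gen k * 1 ≠ gen j ∧ gen k * (-1) ≠ gen j ∧ gen k * gI ≠ gen j ∧ gen k * (-gI) ≠ gen j := by
  decide

/-- **Distinct generators do not divide each other** (they are pairwise non-associated
primes). [folklore] -/
theorem not_dvd_gen_of_ne {k j : Fin 8} (h : k ≠ j) : ¬ gen k ∣ gen j := by
  intro hd
  obtain ⟨u, hu⟩ := (prime_gen k).associated_of_dvd (prime_gen j) hd
  obtain ⟨h1, h2, h3, h4⟩ := gen_mul_unit_ne k j h
  rcases eq_of_isUnit u.isUnit with e | e | e | e <;> rw [e] at hu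
  exacts [h1 hu, h2 hu, h3 hu, h4 hu]

/-- A residue with no square root is not a square. [folklore] -/
theorem not_isSquare_of_forall_ne {q : ℕ} (a : ZMod q) (h : ∀ r : ZMod q, a ≠ r * r) :
    ¬ IsSquare a := fun ⟨r, hr⟩ => h r hr

/-! ### The valuation parities on the generators -/

/-- **`ord_p` of the generators**: `mult_{gen k}(gen j) = [j = k]` and `mult_{gen k}(i) = 0`
(the `gen j` are pairwise non-associated primes, `i` is a unit). [folklore] -/
theorem ofPrime_gen_gen (k j : Fin 8) :
    MulBit.ofPrime (gen k) (prime_gen k) (gen j) = if j = k then 1 else 0 := by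
  split_ifs with h
  · subst h
    rw [MulBit.ofPrime_apply, multiplicity_self, Nat.cast_one]
  · exact MulBit.ofPrime_of_not_dvd (prime_gen k) (not_dvd_gen_of_ne (Ne.symm h))

/-- `mult_{gen k}(i) = 0`. [folklore] -/
theorem ofPrime_gen_gI (k : Fin 8) : MulBit.ofPrime (gen k) (prime_gen k) gI = 0 :=
  MulBit.ofPrime_of_not_dvd (prime_gen k) (not_prime_dvd_gI (prime_gen k))

/-! ### The quadratic-residue bits on the generators -/

/-- `qr5a` on the generators `i, gen 0, …, gen 7`: `[1, 0, 1, 0, 0, 1, 1, 1, 0]`. [folklore] -/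
theorem qr5a_table :
    MulBit.qr5a gI = 1 ∧ (∀ j : Fin 8, MulBit.qr5a (gen j) = (![0, 1, 0, 0, 1, 1, 1, 0] : Fin 8 → ZMod 2) j) := by
  refine ⟨?_, fun j => ?_⟩
  · rw [MulBit.qr5a_of_not_dvd (not_prime_dvd_gI prime_g5a), qrBitZMod_eq_one_iff]
    exact not_isSquare_of_forall_ne _ (by decide)
  · fin_cases j
    · show MulBit.qr5a (gen 0) = 0
      rw [MulBit.qr5a_of_not_dvd (not_dvd_gen_of_ne (k := 2) (j := 0) (by decide)),
        qrBitZMod_eq_zero_iff]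
      exact ⟨2, by decide⟩
    · show MulBit.qr5a (gen 1) = 1
      rw [MulBit.qr5a_of_not_dvd (not_dvd_gen_of_ne (k := 2) (j := 1) (by decide)),
        qrBitZMod_eq_one_iff]
      exact not_isSquare_of_forall_ne _ (by decide)
    · -- `g5a` itself: unit part `1`
      show MulBit.qr5a (gen 2) = 0
      rw [show gen 2 = g5a ^ 1 * 1 by simp [gen, g5a], MulBit.qr5a_pow_mul (c := 1)
        (fun h => prime_g5a.not_unit (isUnit_of_dvd_one h)), map_one, qrBitZMod_eq_zero_iff]
      exact ⟨1, by ring⟩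
    · show MulBit.qr5a (gen 3) = 0
      rw [MulBit.qr5a_of_not_dvd (not_dvd_gen_of_ne (k := 2) (j := 3) (by decide)),
        qrBitZMod_eq_zero_iff]
      exact ⟨2, by decide⟩
    · show MulBit.qr5a (gen 4) = 1
      rw [MulBit.qr5a_of_not_dvd (not_dvd_gen_of_ne (k := 2) (j := 4) (by decide)),
        qrBitZMod_eq_one_iff]
      exact not_isSquare_of_forall_ne _ (by decide)
    · show MulBit.qr5a (gen 5) = 1
      rw [MulBit.qr5a_of_not_dvd (not_dvd_gen_of_ne (k := 2) (j := 5) (by decide)),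
        qrBitZMod_eq_one_iff]
      exact not_isSquare_of_forall_ne _ (by decide)
    · show MulBit.qr5a (gen 6) = 1
      rw [MulBit.qr5a_of_not_dvd (not_dvd_gen_of_ne (k := 2) (j := 6) (by decide)),
        qrBitZMod_eq_one_iff]
      exact not_isSquare_of_forall_ne _ (by decide)
    · show MulBit.qr5a (gen 7) = 0
      rw [MulBit.qr5a_of_not_dvd (not_dvd_gen_of_ne (k := 2) (j := 7) (by decide)),
        qrBitZMod_eq_zero_iff]
      exact ⟨2, by decide⟩

/-- `qr5b` on the generators `i, gen 0, …, gen 7`: `[1, 1, 1, 0, 0, 1, 1, 0, 1]`. [folklore] -/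
theorem qr5b_table :
    MulBit.qr5b gI = 1 ∧ (∀ j : Fin 8, MulBit.qr5b (gen j) = (![1, 1, 0, 0, 1, 1, 0, 1] : Fin 8 → ZMod 2) j) := by
  refine ⟨?_, fun j => ?_⟩
  · rw [MulBit.qr5b_of_not_dvd (not_prime_dvd_gI prime_g5b), qrBitZMod_eq_one_iff]
    exact not_isSquare_of_forall_ne _ (by decide)
  · fin_cases j
    · show MulBit.qr5b (gen 0) = 1
      rw [MulBit.qr5b_of_not_dvd (not_dvd_gen_of_ne (k := 3) (j := 0) (by decide)),
        qrBitZMod_eq_one_iff]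
      exact not_isSquare_of_forall_ne _ (by decide)
    · show MulBit.qr5b (gen 1) = 1
      rw [MulBit.qr5b_of_not_dvd (not_dvd_gen_of_ne (k := 3) (j := 1) (by decide)),
        qrBitZMod_eq_one_iff]
      exact not_isSquare_of_forall_ne _ (by decide)
    · show MulBit.qr5b (gen 2) = 0
      rw [MulBit.qr5b_of_not_dvd (not_dvd_gen_of_ne (k := 3) (j := 2) (by decide)),
        qrBitZMod_eq_zero_iff]
      exact ⟨2, by decide⟩
    · -- `g5b` itself: unit part `1`
      show MulBit.qr5b (gen 3) = 0
      rw [show gen 3 = g5b ^ 1 * 1 by simp [gen, g5b], MulBit.qr5b_pow_mul (c := 1)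
        (fun h => prime_g5b.not_unit (isUnit_of_dvd_one h)), map_one, qrBitZMod_eq_zero_iff]
      exact ⟨1, by ring⟩
    · show MulBit.qr5b (gen 4) = 1
      rw [MulBit.qr5b_of_not_dvd (not_dvd_gen_of_ne (k := 3) (j := 4) (by decide)),
        qrBitZMod_eq_one_iff]
      exact not_isSquare_of_forall_ne _ (by decide)
    · show MulBit.qr5b (gen 5) = 1
      rw [MulBit.qr5b_of_not_dvd (not_dvd_gen_of_ne (k := 3) (j := 5) (by decide)),
        qrBitZMod_eq_one_iff]
      exact not_isSquare_of_forall_ne _ (by decide)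
    · show MulBit.qr5b (gen 6) = 0
      rw [MulBit.qr5b_of_not_dvd (not_dvd_gen_of_ne (k := 3) (j := 6) (by decide)),
        qrBitZMod_eq_zero_iff]
      exact ⟨2, by decide⟩
    · show MulBit.qr5b (gen 7) = 1
      rw [MulBit.qr5b_of_not_dvd (not_dvd_gen_of_ne (k := 3) (j := 7) (by decide)),
        qrBitZMod_eq_one_iff]
      exact not_isSquare_of_forall_ne _ (by decide)

/-- `qr41a` on the generators `i, gen 0, …, gen 7`: `[0, 0, 1, 1, 1, 0, 0, 1, 1]`. [folklore] -/
theorem qr41a_table :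
    MulBit.qr41a gI = 0 ∧ (∀ j : Fin 8, MulBit.qr41a (gen j) = (![0, 1, 1, 1, 0, 0, 1, 1] : Fin 8 → ZMod 2) j) := by
  refine ⟨?_, fun j => ?_⟩
  · rw [MulBit.qr41a_of_not_dvd (not_prime_dvd_gI prime_g41a), qrBitZMod_eq_zero_iff]
    exact ⟨3, by decide⟩
  · fin_cases j
    · show MulBit.qr41a (gen 0) = 0
      rw [MulBit.qr41a_of_not_dvd (not_dvd_gen_of_ne (k := 4) (j := 0) (by decide)),
        qrBitZMod_eq_zero_iff]
      exact ⟨16, by decide⟩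
    · show MulBit.qr41a (gen 1) = 1
      rw [MulBit.qr41a_of_not_dvd (not_dvd_gen_of_ne (k := 4) (j := 1) (by decide)),
        qrBitZMod_eq_one_iff]
      exact not_isSquare_of_forall_ne _ (by decide)
    · show MulBit.qr41a (gen 2) = 1
      rw [MulBit.qr41a_of_not_dvd (not_dvd_gen_of_ne (k := 4) (j := 2) (by decide)),
        qrBitZMod_eq_one_iff]
      exact not_isSquare_of_forall_ne _ (by decide)
    · show MulBit.qr41a (gen 3) = 1
      rw [MulBit.qr41a_of_not_dvd (not_dvd_gen_of_ne (k := 4) (j := 3) (by decide)),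
        qrBitZMod_eq_one_iff]
      exact not_isSquare_of_forall_ne _ (by decide)
    · -- `g41a` itself: unit part `1`
      show MulBit.qr41a (gen 4) = 0
      rw [show gen 4 = g41a ^ 1 * 1 by simp [gen, g41a], MulBit.qr41a_pow_mul (c := 1)
        (fun h => prime_g41a.not_unit (isUnit_of_dvd_one h)), map_one, qrBitZMod_eq_zero_iff]
      exact ⟨1, by ring⟩
    · show MulBit.qr41a (gen 5) = 0
      rw [MulBit.qr41a_of_not_dvd (not_dvd_gen_of_ne (k := 4) (j := 5) (by decide)),
        qrBitZMod_eq_zero_iff]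
      exact ⟨16, by decide⟩
    · show MulBit.qr41a (gen 6) = 1
      rw [MulBit.qr41a_of_not_dvd (not_dvd_gen_of_ne (k := 4) (j := 6) (by decide)),
        qrBitZMod_eq_one_iff]
      exact not_isSquare_of_forall_ne _ (by decide)
    · show MulBit.qr41a (gen 7) = 1
      rw [MulBit.qr41a_of_not_dvd (not_dvd_gen_of_ne (k := 4) (j := 7) (by decide)),
        qrBitZMod_eq_one_iff]
      exact not_isSquare_of_forall_ne _ (by decide)

/-- `qr41b` on the generators `i, gen 0, …, gen 7`: `[0, 0, 1, 1, 1, 0, 0, 1, 1]`. [folklore] -/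
theorem qr41b_table :
    MulBit.qr41b gI = 0 ∧ (∀ j : Fin 8, MulBit.qr41b (gen j) = (![0, 1, 1, 1, 0, 0, 1, 1] : Fin 8 → ZMod 2) j) := by
  refine ⟨?_, fun j => ?_⟩
  · rw [MulBit.qr41b_of_not_dvd (not_prime_dvd_gI prime_g41b), qrBitZMod_eq_zero_iff]
    exact ⟨14, by decide⟩
  · fin_cases j
    · show MulBit.qr41b (gen 0) = 0
      rw [MulBit.qr41b_of_not_dvd (not_dvd_gen_of_ne (k := 5) (j := 0) (by decide)),
        qrBitZMod_eq_zero_iff]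
      exact ⟨19, by decide⟩
    · show MulBit.qr41b (gen 1) = 1
      rw [MulBit.qr41b_of_not_dvd (not_dvd_gen_of_ne (k := 5) (j := 1) (by decide)),
        qrBitZMod_eq_one_iff]
      exact not_isSquare_of_forall_ne _ (by decide)
    · show MulBit.qr41b (gen 2) = 1
      rw [MulBit.qr41b_of_not_dvd (not_dvd_gen_of_ne (k := 5) (j := 2) (by decide)),
        qrBitZMod_eq_one_iff]
      exact not_isSquare_of_forall_ne _ (by decide)
    · show MulBit.qr41b (gen 3) = 1
      rw [MulBit.qr41b_of_not_dvd (not_dvd_gen_of_ne (k := 5) (j := 3) (by decide)),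
        qrBitZMod_eq_one_iff]
      exact not_isSquare_of_forall_ne _ (by decide)
    · show MulBit.qr41b (gen 4) = 0
      rw [MulBit.qr41b_of_not_dvd (not_dvd_gen_of_ne (k := 5) (j := 4) (by decide)),
        qrBitZMod_eq_zero_iff]
      exact ⟨16, by decide⟩
    · -- `g41b` itself: unit part `1`
      show MulBit.qr41b (gen 5) = 0
      rw [show gen 5 = g41b ^ 1 * 1 by simp [gen, g41b], MulBit.qr41b_pow_mul (c := 1)
        (fun h => prime_g41b.not_unit (isUnit_of_dvd_one h)), map_one, qrBitZMod_eq_zero_iff]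
      exact ⟨1, by ring⟩
    · show MulBit.qr41b (gen 6) = 1
      rw [MulBit.qr41b_of_not_dvd (not_dvd_gen_of_ne (k := 5) (j := 6) (by decide)),
        qrBitZMod_eq_one_iff]
      exact not_isSquare_of_forall_ne _ (by decide)
    · show MulBit.qr41b (gen 7) = 1
      rw [MulBit.qr41b_of_not_dvd (not_dvd_gen_of_ne (k := 5) (j := 7) (by decide)),
        qrBitZMod_eq_one_iff]
      exact not_isSquare_of_forall_ne _ (by decide)

/-- `qr73a` on the generators `i, gen 0, …, gen 7`: `[0, 1, 0, 0, 1, 1, 1, 0, 0]`. [folklore] -/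
theorem qr73a_table :
    MulBit.qr73a gI = 0 ∧ (∀ j : Fin 8, MulBit.qr73a (gen j) = (![1, 0, 0, 1, 1, 1, 0, 0] : Fin 8 → ZMod 2) j) := by
  refine ⟨?_, fun j => ?_⟩
  · rw [MulBit.qr73a_of_not_dvd (not_prime_dvd_gI prime_g73a), qrBitZMod_eq_zero_iff]
    exact ⟨22, by decide⟩
  · fin_cases j
    · show MulBit.qr73a (gen 0) = 1
      rw [MulBit.qr73a_of_not_dvd (not_dvd_gen_of_ne (k := 6) (j := 0) (by decide)),
        qrBitZMod_eq_one_iff]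
      exact not_isSquare_of_forall_ne _ (by decide)
    · show MulBit.qr73a (gen 1) = 0
      rw [MulBit.qr73a_of_not_dvd (not_dvd_gen_of_ne (k := 6) (j := 1) (by decide)),
        qrBitZMod_eq_zero_iff]
      exact ⟨21, by decide⟩
    · show MulBit.qr73a (gen 2) = 0
      rw [MulBit.qr73a_of_not_dvd (not_dvd_gen_of_ne (k := 6) (j := 2) (by decide)),
        qrBitZMod_eq_zero_iff]
      exact ⟨11, by decide⟩
    · show MulBit.qr73a (gen 3) = 1
      rw [MulBit.qr73a_of_not_dvd (not_dvd_gen_of_ne (k := 6) (j := 3) (by decide)),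
        qrBitZMod_eq_one_iff]
      exact not_isSquare_of_forall_ne _ (by decide)
    · show MulBit.qr73a (gen 4) = 1
      rw [MulBit.qr73a_of_not_dvd (not_dvd_gen_of_ne (k := 6) (j := 4) (by decide)),
        qrBitZMod_eq_one_iff]
      exact not_isSquare_of_forall_ne _ (by decide)
    · show MulBit.qr73a (gen 5) = 1
      rw [MulBit.qr73a_of_not_dvd (not_dvd_gen_of_ne (k := 6) (j := 5) (by decide)),
        qrBitZMod_eq_one_iff]
      exact not_isSquare_of_forall_ne _ (by decide)
    · -- `g73a` itself: unit part `1`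
      show MulBit.qr73a (gen 6) = 0
      rw [show gen 6 = g73a ^ 1 * 1 by simp [gen, g73a], MulBit.qr73a_pow_mul (c := 1)
        (fun h => prime_g73a.not_unit (isUnit_of_dvd_one h)), map_one, qrBitZMod_eq_zero_iff]
      exact ⟨1, by ring⟩
    · show MulBit.qr73a (gen 7) = 0
      rw [MulBit.qr73a_of_not_dvd (not_dvd_gen_of_ne (k := 6) (j := 7) (by decide)),
        qrBitZMod_eq_zero_iff]
      exact ⟨4, by decide⟩

/-- `qr73b` on the generators `i, gen 0, …, gen 7`: `[0, 1, 0, 1, 0, 1, 1, 0, 0]`. [folklore] -/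
theorem qr73b_table :
    MulBit.qr73b gI = 0 ∧ (∀ j : Fin 8, MulBit.qr73b (gen j) = (![1, 0, 1, 0, 1, 1, 0, 0] : Fin 8 → ZMod 2) j) := by
  refine ⟨?_, fun j => ?_⟩
  · rw [MulBit.qr73b_of_not_dvd (not_prime_dvd_gI prime_g73b), qrBitZMod_eq_zero_iff]
    exact ⟨10, by decide⟩
  · fin_cases j
    · show MulBit.qr73b (gen 0) = 1
      rw [MulBit.qr73b_of_not_dvd (not_dvd_gen_of_ne (k := 7) (j := 0) (by decide)),
        qrBitZMod_eq_one_iff]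
      exact not_isSquare_of_forall_ne _ (by decide)
    · show MulBit.qr73b (gen 1) = 0
      rw [MulBit.qr73b_of_not_dvd (not_dvd_gen_of_ne (k := 7) (j := 1) (by decide)),
        qrBitZMod_eq_zero_iff]
      exact ⟨21, by decide⟩
    · show MulBit.qr73b (gen 2) = 1
      rw [MulBit.qr73b_of_not_dvd (not_dvd_gen_of_ne (k := 7) (j := 2) (by decide)),
        qrBitZMod_eq_one_iff]
      exact not_isSquare_of_forall_ne _ (by decide)
    · show MulBit.qr73b (gen 3) = 0
      rw [MulBit.qr73b_of_not_dvd (not_dvd_gen_of_ne (k := 7) (j := 3) (by decide)),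
        qrBitZMod_eq_zero_iff]
      exact ⟨11, by decide⟩
    · show MulBit.qr73b (gen 4) = 1
      rw [MulBit.qr73b_of_not_dvd (not_dvd_gen_of_ne (k := 7) (j := 4) (by decide)),
        qrBitZMod_eq_one_iff]
      exact not_isSquare_of_forall_ne _ (by decide)
    · show MulBit.qr73b (gen 5) = 1
      rw [MulBit.qr73b_of_not_dvd (not_dvd_gen_of_ne (k := 7) (j := 5) (by decide)),
        qrBitZMod_eq_one_iff]
      exact not_isSquare_of_forall_ne _ (by decide)
    · show MulBit.qr73b (gen 6) = 0
      rw [MulBit.qr73b_of_not_dvd (not_dvd_gen_of_ne (k := 7) (j := 6) (by decide)),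
        qrBitZMod_eq_zero_iff]
      exact ⟨4, by decide⟩
    · -- `g73b` itself: unit part `1`
      show MulBit.qr73b (gen 7) = 0
      rw [show gen 7 = g73b ^ 1 * 1 by simp [gen, g73b], MulBit.qr73b_pow_mul (c := 1)
        (fun h => prime_g73b.not_unit (isUnit_of_dvd_one h)), map_one, qrBitZMod_eq_zero_iff]
      exact ⟨1, by ring⟩

/-! ### The dyadic bits on the generators -/

/-- `dyRe` on the generators `i, gen 0, …, gen 7`: `[1, 0, 0, 1, 1, 0, 0, 1, 1]`. [folklore] -/
theorem dyRe_table :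
    MulBit.dyRe gI = 1 ∧ (∀ j : Fin 8, MulBit.dyRe (gen j) = (![0, 0, 1, 1, 0, 0, 1, 1] : Fin 8 → ZMod 2) j) := by
  refine ⟨?_, fun j => ?_⟩
  · rw [MulBit.dyRe_of_not_dvd (not_prime_dvd_gI prime_g2)]; decide
  · fin_cases j
    · show MulBit.dyRe (gen 0) = 0
      rw [show gen 0 = g2 ^ 1 * 1 by simp [gen], MulBit.dyRe_pow_mul (c := 1)
        (fun h => prime_g2.not_unit (isUnit_of_dvd_one h))]
      decide
    · show MulBit.dyRe (gen 1) = 0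
      rw [MulBit.dyRe_of_not_dvd (not_dvd_gen_of_ne (k := 0) (j := 1) (by decide))]
      decide
    · show MulBit.dyRe (gen 2) = 1
      rw [MulBit.dyRe_of_not_dvd (not_dvd_gen_of_ne (k := 0) (j := 2) (by decide))]
      decide
    · show MulBit.dyRe (gen 3) = 1
      rw [MulBit.dyRe_of_not_dvd (not_dvd_gen_of_ne (k := 0) (j := 3) (by decide))]
      decide
    · show MulBit.dyRe (gen 4) = 0
      rw [MulBit.dyRe_of_not_dvd (not_dvd_gen_of_ne (k := 0) (j := 4) (by decide))]
      decide
    · show MulBit.dyRe (gen 5) = 0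
      rw [MulBit.dyRe_of_not_dvd (not_dvd_gen_of_ne (k := 0) (j := 5) (by decide))]
      decide
    · show MulBit.dyRe (gen 6) = 1
      rw [MulBit.dyRe_of_not_dvd (not_dvd_gen_of_ne (k := 0) (j := 6) (by decide))]
      decide
    · show MulBit.dyRe (gen 7) = 1
      rw [MulBit.dyRe_of_not_dvd (not_dvd_gen_of_ne (k := 0) (j := 7) (by decide))]
      decide

/-- `dyNrm` on the generators `i, gen 0, …, gen 7`: `[0, 0, 0, 1, 1, 0, 0, 0, 0]`. [folklore] -/
theorem dyNrm_table :
    MulBit.dyNrm gI = 0 ∧ (∀ j : Fin 8, MulBit.dyNrm (gen j) = (![0, 0, 1, 1, 0, 0, 0, 0] : Fin 8 → ZMod 2) j) := by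
  refine ⟨?_, fun j => ?_⟩
  · rw [MulBit.dyNrm_of_not_dvd (not_prime_dvd_gI prime_g2)]; decide
  · fin_cases j
    · show MulBit.dyNrm (gen 0) = 0
      rw [show gen 0 = g2 ^ 1 * 1 by simp [gen], MulBit.dyNrm_pow_mul (c := 1)
        (fun h => prime_g2.not_unit (isUnit_of_dvd_one h))]
      decide
    · show MulBit.dyNrm (gen 1) = 0
      rw [MulBit.dyNrm_of_not_dvd (not_dvd_gen_of_ne (k := 0) (j := 1) (by decide))]
      decide
    · show MulBit.dyNrm (gen 2) = 1
      rw [MulBit.dyNrm_of_not_dvd (not_dvd_gen_of_ne (k := 0) (j := 2) (by decide))]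
      decide
    · show MulBit.dyNrm (gen 3) = 1
      rw [MulBit.dyNrm_of_not_dvd (not_dvd_gen_of_ne (k := 0) (j := 3) (by decide))]
      decide
    · show MulBit.dyNrm (gen 4) = 0
      rw [MulBit.dyNrm_of_not_dvd (not_dvd_gen_of_ne (k := 0) (j := 4) (by decide))]
      decide
    · show MulBit.dyNrm (gen 5) = 0
      rw [MulBit.dyNrm_of_not_dvd (not_dvd_gen_of_ne (k := 0) (j := 5) (by decide))]
      decide
    · show MulBit.dyNrm (gen 6) = 0
      rw [MulBit.dyNrm_of_not_dvd (not_dvd_gen_of_ne (k := 0) (j := 6) (by decide))]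
      decide
    · show MulBit.dyNrm (gen 7) = 0
      rw [MulBit.dyNrm_of_not_dvd (not_dvd_gen_of_ne (k := 0) (j := 7) (by decide))]
      decide

/-- `dyT` on the generators `i, gen 0, …, gen 7`: `[0, 0, 1, 1, 0, 0, 0, 1, 1]`. [folklore] -/
theorem dyT_table :
    MulBit.dyT gI = 0 ∧ (∀ j : Fin 8, MulBit.dyT (gen j) = (![0, 1, 1, 0, 0, 0, 1, 1] : Fin 8 → ZMod 2) j) := by
  refine ⟨?_, fun j => ?_⟩
  · rw [MulBit.dyT_of_not_dvd (not_prime_dvd_gI prime_g2)]; decide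
  · fin_cases j
    · show MulBit.dyT (gen 0) = 0
      rw [show gen 0 = g2 ^ 1 * 1 by simp [gen], MulBit.dyT_pow_mul (c := 1)
        (fun h => prime_g2.not_unit (isUnit_of_dvd_one h))]
      decide
    · show MulBit.dyT (gen 1) = 1
      rw [MulBit.dyT_of_not_dvd (not_dvd_gen_of_ne (k := 0) (j := 1) (by decide))]
      decide
    · show MulBit.dyT (gen 2) = 1
      rw [MulBit.dyT_of_not_dvd (not_dvd_gen_of_ne (k := 0) (j := 2) (by decide))]
      decide
    · show MulBit.dyT (gen 3) = 0
      rw [MulBit.dyT_of_not_dvd (not_dvd_gen_of_ne (k := 0) (j := 3) (by decide))]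
      decide
    · show MulBit.dyT (gen 4) = 0
      rw [MulBit.dyT_of_not_dvd (not_dvd_gen_of_ne (k := 0) (j := 4) (by decide))]
      decide
    · show MulBit.dyT (gen 5) = 0
      rw [MulBit.dyT_of_not_dvd (not_dvd_gen_of_ne (k := 0) (j := 5) (by decide))]
      decide
    · show MulBit.dyT (gen 6) = 1
      rw [MulBit.dyT_of_not_dvd (not_dvd_gen_of_ne (k := 0) (j := 6) (by decide))]
      decide
    · show MulBit.dyT (gen 7) = 1
      rw [MulBit.dyT_of_not_dvd (not_dvd_gen_of_ne (k := 0) (j := 7) (by decide))]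
      decide

end Literature.Barriers.BirchSwinnertonDyer.DokchitserDokchitser2011
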